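import Summits.QuantumFields.YangMills.Theorems.AlphaInputsT3ACv3LinearLiftTorus
import HarnessLib

/-!
# `AlphaInputsT3ACv3LinearLiftLocal` — (LL) STEP L4′: LOCALITY OF THE EXACT LINEAR LIFT — the fine curl of `lift k A` at `x` reads the coarse curl of `A` ONLY on the coarse sites of the
# `3^d`-cell neighbourhood of the cell of `x` — cell `ym3-torus`, width seat `ym-ust-19936-w2` (g0); for the REGIONAL assembly of ★alpha-2 g5 (OWNER (LL) DEDUP RULING 2026-08-27T23:33Z)

WHAT.  `Near k x y` := every coordinate of the coarse site `y` is the cell index of `x` or one of its two neighbours on the circle (`y i = q(x i) − r`, `r ∈ {−1,0,1}`).  Then: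
* `weight_eq_zero_of_not_near` — the `S²`-weight of `y` at `x` vanishes unless `Near k x y` (`PS_eq_zero_of_far`);
* ★ `abs_S2_le_local` — `|S2 k G x μ ν| ≤ 18^d · ε / (L^k)²` as soon as `|G y μ ν| ≤ ε` for the `y` NEAR `x` only;
* ★★ `abs_curlAt_lift_le_local` — `|curlAt (lift k A) x μ ν| ≤ 18^d · ε / (L^k)²` as soon as `|curlAt A y μ ν| ≤ ε` for the coarse sites `y` near `x`: the INTERIOR cells of ANY union of
  level-`k` cells inherit the torus bound from a curl hypothesis on the 1-cell thickening only; the ≤ 1-cell boundary layer is the regional assembler's (alpha-2 g5) business.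
* `near_iff_iterBlockOf` — `Near` rephrased with the `k`-fold block point: `y i = (iterBlockOf k x) i − r`.
HONEST FRAMING.  Bookkeeping over `…LinearLiftTorus`; (LL)-regional and (FL) are NOT discharged here; count-neutral helper toward the (FL) row of 2′∕2′χ (`--supports stmt-QuantumFields-19936`);
registry untouched.  YM₃ on the torus is a RUNG of the programme, not the Clay problem; no claim about d = 4, infinite volume or a mass gap.

References: T. Bałaban, Commun. Math. Phys. 109 (1987) 249–301 [Balaban1987RG1] ((0.1) p.251, (0.4) p.253); Commun. Math. Phys. 95 (1984) 17–40 [Balaban1984PropagatorsI] ((1.18) p.20).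
-/

set_option autoImplicit false

noncomputable section

namespace Summit.QuantumFields.YangMills.Theorems.LinearLiftSpread

open Finset
open Literature.MathematicalPhysics.QuantumFieldTheory.Balaban1983to89
open Literature.MathematicalPhysics.QuantumFieldTheory.Balaban1983to89.B5Eq118OneStroke (iterBlockOf val_iterBlockOf)
open Summit.QuantumFields.YangMills.Theorems.AbelianEML (curlAt)
open Summit.QuantumFields.YangMills.Theorems.LinearLiftProfile

variable {P : Params} (k : ℕ)

/-- **`y` IS NEAR `x`**: in every coordinate the cell index of `y` is that of `x` or one of its two neighbours on the circle. [folklore] -/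
def Near (x : Site P 0) (y : Site P k) : Prop :=
  ∀ i : Fin P.d, ∃ r ∈ trip, y i = (((qIdx (hh P k) (x i) : ℤ) - r : ℤ) : ZMod (P.sitesPerDir k))

/-- Off the neighbourhood the `S²`-weight vanishes (one coordinate profile is `0` by `PS_eq_zero_of_far`). [folklore] -/
theorem weight_eq_zero_of_not_near (x : Site P 0) (y : Site P k) (μ ν : Fin P.d) (hμν : μ ≠ ν) (hy : ¬ Near k x y) :
    Ptau (hh P k) (x μ) (y μ) * Ptau (hh P k) (x ν) (y ν) * ∏ i ∈ (univ.erase μ).erase ν, Psig (hh P k) (x i) (y i) = 0 := by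
  unfold Near at hy
  push Not at hy
  obtain ⟨i, hi⟩ := hy
  have hfar : ∀ r ∈ trip, y i ≠ (((qIdx (hh P k) (x i) : ℤ) - r : ℤ) : ZMod (P.sitesPerDir k)) := fun r hr h => hi r hr h
  by_cases hμ : i = μ
  · subst hμ
    have : Ptau (hh P k) (x i) (y i) = 0 := PS_eq_zero_of_far (hh P k) (tau (hh P k)) _ _ (y i) hfar
    rw [this]; ring
  · by_cases hν : i = ν
    · subst hν
      have : Ptau (hh P k) (x i) (y i) = 0 := PS_eq_zero_of_far (hh P k) (tau (hh P k)) _ _ (y i) hfar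
      rw [this]; ring
    · have hmem : i ∈ (univ.erase μ).erase ν := mem_erase.mpr ⟨hν, mem_erase.mpr ⟨hμ, mem_univ i⟩⟩
      have : Psig (hh P k) (x i) (y i) = 0 := PS_eq_zero_of_far (hh P k) (sigma (hh P k)) _ _ (y i) hfar
      rw [prod_eq_zero hmem this]; ring

/-- The `k`-fold block point of `x` in coordinates: `(coarsen_k x)_i = q(x_i)`. [cite: Balaban1984PropagatorsI, (1.18) p.20] -/
theorem iterBlockOf_apply_eq (hk : k ≤ P.m + P.K) (x : Site P 0) (i : Fin P.d) :
    (iterBlockOf k x) i = ((qIdx (hh P k) (x i) : ℕ) : ZMod (P.sitesPerDir k)) := by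
  rw [← ZMod.natCast_zmod_val ((iterBlockOf k x) i), val_iterBlockOf k hk x i]
  unfold qIdx
  rw [hside]

/-- `x`'s own cell is near `x` (so a local curl hypothesis is never vacuous). [folklore] -/
theorem near_self (hk : k ≤ P.m + P.K) (x : Site P 0) : Near k x (iterBlockOf k x) := by
  intro i
  refine ⟨0, by simp [trip], ?_⟩
  rw [sub_zero, Int.cast_natCast, iterBlockOf_apply_eq k hk x i]

/-- `Near` with the `k`-fold block point: `y_i = (coarsen_k x)_i − r`, `r ∈ {−1,0,1}`. [folklore] -/
theorem near_iff_iterBlockOf (hk : k ≤ P.m + P.K) (x : Site P 0) (y : Site P k) :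
    Near k x y ↔ ∀ i : Fin P.d, ∃ r ∈ trip, y i = (iterBlockOf k x) i - (r : ZMod (P.sitesPerDir k)) := by
  unfold Near
  refine forall_congr' fun i => exists_congr fun r => and_congr_right fun _ => ?_
  rw [iterBlockOf_apply_eq k hk x i, Int.cast_sub, Int.cast_natCast]

/-- **★ THE LOCAL CURL-SPREADING BOUND**: `|S2 k G (x; μ, ν)| ≤ 18^d · ε / (L^k)²` as soon as `|G(y; μ, ν)| ≤ ε` for the coarse sites `y` NEAR `x`. [folklore] -/
theorem abs_S2_le_local (hk : k ≤ P.m + P.K) (G : Site P k → Fin P.d → Fin P.d → ℝ) (x : Site P 0) {μ ν : Fin P.d} (hμν : μ ≠ ν) {ε : ℝ}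
    (hG : ∀ y : Site P k, Near k x y → |G y μ ν| ≤ ε) :
    |S2 k G x μ ν| ≤ (18 : ℝ) ^ P.d * ε / ((P.L : ℝ) ^ k) ^ 2 := by
  classical
  let G' : Site P k → Fin P.d → Fin P.d → ℝ := fun y μ' ν' => if Near k x y then G y μ' ν' else 0
  have hS : S2 k G x μ ν = S2 k G' x μ ν := by
    unfold S2
    refine sum_congr rfl fun y _ => ?_
    by_cases hy : Near k x y
    · simp only [G', if_pos hy]
    · simp only [G', if_neg hy]
      rw [weight_eq_zero_of_not_near k x y μ ν hμν hy]; ring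
  rw [hS]
  have hε : 0 ≤ ε := (abs_nonneg _).trans (hG _ (near_self k hk x))
  refine abs_S2_le k G' x hμν fun y => ?_
  by_cases hy : Near k x y
  · simp only [G', if_pos hy]; exact hG y hy
  · simp only [G', if_neg hy, abs_zero]; exact hε

/-- **★★ THE LOCAL CURL BOUND OF THE LIFT**: `|curlAt (lift k A) (x; μ, ν)| ≤ 18^d · ε / (L^k)²` as soon as `|curlAt A (y; μ, ν)| ≤ ε` for the coarse sites `y` NEAR `x` — interior cells
of any union of level-`k` cells inherit the torus bound from a hypothesis on the 1-cell thickening only. [cite: Balaban1987RG1, (0.4) p.253] -/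
theorem abs_curlAt_lift_le_local (hk : k ≤ P.m + P.K) (A : PBond P k → ℝ) (x : Site P 0) {μ ν : Fin P.d} (hμν : μ ≠ ν) {ε : ℝ}
    (hA : ∀ y : Site P k, Near k x y → |curlAt A y μ ν| ≤ ε) :
    |curlAt (lift k A) x μ ν| ≤ (18 : ℝ) ^ P.d * ε / ((P.L : ℝ) ^ k) ^ 2 := by
  rw [curlAt_lift k hk A x hμν]
  exact abs_S2_le_local k hk (fun y μ' ν' => curlAt A y μ' ν') x hμν hA

end Summit.QuantumFields.YangMills.Theorems.LinearLiftSpread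

end
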